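/-
Copyright (c) 2026. All rights reserved.
Released under Apache 2.0 license as described in the file LICENSE.
-/
import Literature.Geometry.Kaehler.ComplexTorusQuaternionXSixSpecialCyclesDegreeStructure
import Literature.Geometry.Kaehler.ComplexTorusQuaternionXSixSpecialCyclesPointCount
import Literature.Geometry.Kaehler.ComplexTorusQuaternionSpecialVectorStabilizers
import HarnessLib

/-!
# `deg Z(t)_ℚ` is the orbifold mass of the support of `Z(t)` on `X₆ = Γ₆∖ℌ`:
# `2·Σ_{x ∈ L(t) mod O₆^×} e_x⁻¹ = 2·Σ_{[τ] ∈ Pt(t)/Γ₆} |Γ₆,τ|⁻¹` for every `t > 0`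

[tag: complex_torus] [tag: abelian_surface] [tag: quaternion_multiplication] [tag: complex_multiplication]
[tag: shimura_curve] [tag: special_cycles] [tag: cm_points] [tag: elliptic_points]

Kudla–Rapoport–Yang's degree formula (3.4.14) `deg Z(t)_ℚ = 2·Σ_{x ∈ L(t) mod Γ} e_x⁻¹` (`Γ = O_B^×`, `e_x = |Γ_x|`) is a sum
over special VECTORS; the cycle itself is a set of POINTS, `Z(t)(ℂ) = Σ_{x ∈ L(t) mod Γ} pr(D_x)` (3.4.13), `D_x = {z_x, z̄_x}`
the fixed points of `x`, and «each point `η = (A, ι, x)` in `Z(t)(ℂ)` should be counted with multiplicity `1/|Aut(A, ι, x)|`»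
[KRY, p. 53], «the automorphisms of `(A_z, ι_z)` are given by elements in `Γ_z`» [KRY, §3.2 Prop. 3.2.1]. For `D(B) = 6`
(`B = (−1,3)_ℚ`, the maximal order `O₆ = ℤ⟨1, i, j, ij⟩ + ℤe`, `Γ₆ = O₆¹`, `X₆ = Γ₆∖ℌ`) the series has: the lifted support
`Pt(t) = {τ ∈ ℌ : ρ(x)τ = τ for some x ∈ 𝔬, tr x = 0, nr x = t}` and the two-to-one map `[x̂] ↦ [z_x]`, `L(t)/Γ₆ → Pt(t)/Γ₆`,
with fibres `{[x̂], [−x̂]}` (`…XSixSpecialCyclesPointCount`); the stabilisers `Γ_x ⊂ O₆^×` and `e_x` (`…XSixSpecialCyclesDegree`);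
and `Σᶠ_{L(t)/Γ₆} e⁻¹ = 2·Σᶠ_{L(t)/O₆^×} e⁻¹` (`…XSixSpecialCyclesDegreeStructure`). This file closes the triangle on the
points side, for EVERY `t > 0`:

* `card_pointStab_eq_card_unitStab` (§1): **`Γ₆,z_x = Γ_x`** — the stabiliser `Γ₆,τ = {u ∈ Γ₆ : ρ(u)τ = τ}` of the point
  `τ = z_x` has the order `e_x` of the stabiliser of the vector (`u` commutes with `x̂` iff `ρ(u)` fixes `z_x`,
  `commute_iff_moebius_eq_of_special`; a unit commuting with `x̂` has norm `1`), so `|Γ₆,τ| ∈ {2, 4, 6}`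
  (`card_pointStab_eq_two_or_four_or_six`); `card_pointStab_eq_of_rel`: `|Γ₆,τ|` is a class function on `Pt(t)/Γ₆`.
* `finsum_normOne_classes_eq_two_mul_finsum_points` (§2): **`Σᶠ_{[x] ∈ L(t)/Γ₆} e_x⁻¹ = 2·Σᶠ_{[τ] ∈ Pt(t)/Γ₆} |Γ₆,τ|⁻¹`** —
  the two-to-one map `[x̂] ↦ [z_x]` WEIGHTED (`e_{−x} = e_x = |Γ₆,z_x|`).
* `degree_eq_two_mul_finsum_points`, `finsum_unit_classes_eq_finsum_points` (§2): **`deg Z(t)_ℚ = 2·Σᶠ_{L(t)/O₆^×} e⁻¹ =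
  2·Σᶠ_{[τ] ∈ Pt(t)/Γ₆} |Γ₆,τ|⁻¹ = Σ_{P ∈ supp Z(t)} 1/|Γ₆,P/{±1}|`**, the orbifold mass of the support on `X₆`: KRY's index
  set `L(t)/O₆^×` and the points `Pt(t)/Γ₆` are not only equinumerous (`card_specialPoints_eq_card_unit_classes`) but carry
  the same weights. E.g. `Σᶠ_{Pt(1)/Γ₆} |Γ₆,τ|⁻¹ = 2·¼ = ½` (the two elliptic points of order `2`), `Σᶠ_{Pt(3)/Γ₆} |Γ₆,τ|⁻¹ =
  2·⅙ = ⅓` (order `3`): `finsum_points_one`, `finsum_points_three`.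

## Sources

* [KRY] S. Kudla, M. Rapoport, T. Yang, *Modular Forms and Special Cycles on Shimura Curves*, Ann. of Math. Stud. 161
  (2006), §3.2 p. 48 and Prop. 3.2.1 («the automorphisms of `(A_z, ι_z)` are given by elements in `Γ_z`»), §3.4 (3.4.9)–(3.4.11)
  («`D_x` … consists of two points», «`[Γ∖D_t] ≃ Z(t)_ℂ`»), (3.4.13)–(3.4.14), p. 53 («counted with multiplicity
  `1/|Aut(A, ι, x)|`»), Lemma 3.4.3 and Remark 3.4.4. [cite: KudlaRapoportYang2006, §3.2 Prop. 3.2.1; §3.4 (3.4.9)–(3.4.14), Lemma 3.4.3, Remark 3.4.4]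
* [Vignéras] M.-F. Vignéras, *Arithmétique des algèbres de quaternions*, LNM 800 (1980), Ch. IV §1 (the Fuchsian group `𝒪¹`
  acting on `ℌ`, stabilisers of points = unit groups of the CM orders) and Ch. III §5.C. [cite: VignerasLNM800, Ch. IV §1; Ch. III §5.C]
* [BT] P. Bayer, A. Travesa, *Uniformizing functions for certain Shimura curves, in the case `D = 6`*, Acta Arith. 126 (2007),
  §1 Thm. 1.1 (the elliptic points of `X₆` of orders `2, 2, 3, 3`). [cite: BayerTravesa2007, §1 Thm. 1.1]
* [Bergeron] N. Bergeron, *The Spectrum of Hyperbolic Surfaces* (2016), §1.2 p. 15 (centralizer of an elliptic isometry =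
  the isometries fixing the same point). [cite: Bergeron2016, §1.2 p. 15]

## Scope (honest)

Theorems only — no definitions, no named facts, no instances, no notation; `Pt(t)`, `Γ₆,τ`, the quotients and the sums are
inline expressions. The identification of `Γ₆∖ℌ` with `X₆(ℂ)` and of these weighted point classes with the DM-stack `Z(t)_ℂ`
is quoted from the sources, not formalised.
-/

noncomputable section

set_option maxSynthPendingDepth 3

open Quaternion Function Literature.NumberTheory.QuadraticFields.Quadratic

namespace Literature.Geometry.Kaehler.ComplexTorus.QuaternionType

/-! ## §0 Helpers -/

section Helpers

/-- **Two sheets, weighted** (as in `…XSixSpecialCyclesDegreeStructure`): `Σᶠ_Q g ∘ f = 2·Σᶠ_{Q'} g` for a fixed-point-free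
`π` and a surjection `f` with `f ∘ π = f` and fibres `{q, πq}`. [folklore] -/
private theorem finsum_comp_eq_two_mul_finsum₄₁ {Q Q' : Type*} [Finite Q] (π : Q → Q) (hπ : ∀ q, π q ≠ q)
    (f : Q → Q') (hf : Function.Surjective f) (hfπ : ∀ q, f (π q) = f q)
    (hff : ∀ q₁ q₂, f q₁ = f q₂ → q₁ = q₂ ∨ q₁ = π q₂) (g : Q' → ℚ) :
    ∑ᶠ q, g (f q) = 2 * ∑ᶠ q', g q' := by
  classical
  haveI : Finite Q' := Finite.of_surjective f hf
  haveI := Fintype.ofFinite Q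
  haveI := Fintype.ofFinite Q'
  have hfs : ∀ q', f (Function.surjInv hf q') = q' := Function.surjInv_eq hf
  have key : Function.Bijective (Sum.elim (Function.surjInv hf) (π ∘ Function.surjInv hf)) := by
    constructor
    · rintro (a | a) (a' | a') h <;> have h' := congrArg f h <;>
        simp only [Sum.elim_inl, Sum.elim_inr, Function.comp_apply, hfs, hfπ] at h h'
      · rw [h']
      · subst h'; exact absurd h.symm (hπ _)
      · subst h'; exact absurd h (hπ _)
      · rw [h']
    · intro q
      rcases hff q (Function.surjInv hf (f q)) (by rw [hfs]) with h | h
      · exact ⟨Sum.inl (f q), h.symm⟩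
      · exact ⟨Sum.inr (f q), h.symm⟩
  have h1 : ∑ᶠ s : Q' ⊕ Q', g (f (Sum.elim (Function.surjInv hf) (π ∘ Function.surjInv hf) s)) = ∑ᶠ q, g (f q) :=
    finsum_comp (g := fun q ↦ g (f q)) _ key
  rw [← h1, finsum_eq_sum_of_fintype, finsum_eq_sum_of_fintype, Fintype.sum_sum_type, two_mul]
  simp only [Sum.elim_inl, Sum.elim_inr, Function.comp_apply, hfπ, hfs]

/-- `ρ(1)` acts trivially. [folklore] -/
private theorem moebius_rho_castQ_one₄₁ (τ : ℂ) : moebius (rho (-1) 3 (by norm_num) (castQ (-1) 3 (1 : ℍ[ℚ,((-1 : ℤ) : ℚ),((3 : ℤ) : ℚ)]))) τ = τ := by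
  rw [castQ_one, map_one, moebius_apply]
  simp

/-- A trace-zero element of positive norm has at most one fixed point in `ℌ`. [folklore] -/
private theorem fixed_unique₄₁ {x : ℍ[ℚ,((-1 : ℤ) : ℚ),((3 : ℤ) : ℚ)]} (hx : x.re = 0) (ht : 0 < (x * star x).re)
    {τ₁ τ₂ : ℂ} (h₁ : 0 < τ₁.im) (h₂ : 0 < τ₂.im) (hf₁ : moebius (rho (-1) 3 (by norm_num) (castQ (-1) 3 x)) τ₁ = τ₁) (hf₂ : moebius (rho (-1) 3 (by norm_num) (castQ (-1) 3 x)) τ₂ = τ₂) : τ₁ = τ₂ := by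
  have h := fixedPoint_unique_of_trace_eq_zero (trace_rho_castQ_eq_zero _ hx) (det_rho_castQ_pos _ ht)
    (τ₁ := UpperHalfPlane.mk τ₁ h₁) (τ₂ := UpperHalfPlane.mk τ₂ h₂) hf₁ hf₂
  exact congrArg UpperHalfPlane.coe h

/-- The negative of an integral special vector, in coordinates. [folklore] -/
private theorem neg_pureVec₄₁ (x₁ x₂ x₃ : ℤ) :
    (⟨0, ((-x₁ : ℤ) : ℚ), ((-x₂ : ℤ) : ℚ), ((-x₃ : ℤ) : ℚ)⟩ : ℍ[ℚ,((-1 : ℤ) : ℚ),((3 : ℤ) : ℚ)]) = -⟨0, x₁, x₂, x₃⟩ := by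
  rw [QuaternionAlgebra.neg_mk]; ext <;> simp

/-- The `Fin 3` pure vector of a triple is its pure vector. [folklore] -/
private theorem fin_pureVec₄₁ (x : ℤ × ℤ × ℤ) :
    (⟨0, ((![x.1, x.2.1, x.2.2] : Fin 3 → ℤ) 0 : ℚ), ((![x.1, x.2.1, x.2.2] : Fin 3 → ℤ) 1 : ℚ),
      ((![x.1, x.2.1, x.2.2] : Fin 3 → ℤ) 2 : ℚ)⟩ : ℍ[ℚ,((-1 : ℤ) : ℚ),((3 : ℤ) : ℚ)]) = ⟨0, x.1, x.2.1, x.2.2⟩ := rfl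

/-- The `Fin 3` norm form of a triple is its norm form. [folklore] -/
private theorem fin_normForm₄₁ (x : ℤ × ℤ × ℤ) :
    (![x.1, x.2.1, x.2.2] : Fin 3 → ℤ) 0 ^ 2 - 3 * (![x.1, x.2.1, x.2.2] : Fin 3 → ℤ) 1 ^ 2 -
      3 * (![x.1, x.2.1, x.2.2] : Fin 3 → ℤ) 2 ^ 2 = x.1 ^ 2 - 3 * x.2.1 ^ 2 - 3 * x.2.2 ^ 2 := rfl

end Helpers

/-! ## §1 The stabiliser of a special point in `Γ₆` is the stabiliser of its vector: `Γ₆,z_x = Γ_x` -/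

section Stabiliser

/-- **`Γ₆,z_x = Γ_x`, hence `|Γ₆,z_x| = e_x`**: for a special vector `X ∈ 𝔬` (`tr X = 0`, `nr X > 0`) fixing `τ ∈ ℌ`, a unit
`u ∈ O₆` of norm `1` fixes `τ` iff it commutes with `X` (`commute_iff_moebius_eq_of_special`: `X = c·η_τ`), and a unit of
`O₆^×` commuting with `X` has norm `1` (`unitStab_norm_eq_one`) — the stabiliser of the point `z_x` in the Fuchsian group
`Γ₆ = O₆¹` IS Kudla–Rapoport–Yang's `Γ_x` («the automorphisms of `(A_z, ι_z)` are given by elements in `Γ_z`»).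
[cite: KudlaRapoportYang2006, §3.2 Prop. 3.2.1 p. 48 and §3.4 (3.4.14) p. 52] [cite: Bergeron2016, §1.2 p. 15] [cite: VignerasLNM800, Ch. IV §1] -/
theorem card_pointStab_eq_card_unitStab {X : ℍ[ℚ,((-1 : ℤ) : ℚ),((3 : ℤ) : ℚ)]} (hX : X ∈ order (-1) 3) (hre : X.re = 0) (ht : 0 < (X * star X).re)
    {τ : ℂ} (hτ : 0 < τ.im) (hfix : moebius (rho (-1) 3 (by norm_num) (castQ (-1) 3 X)) τ = τ) :
    Nat.card {u : ℍ[ℚ,((-1 : ℤ) : ℚ),((3 : ℤ) : ℚ)] // (u ∈ order (-1) 3 ∨ u - ⟨1/2, 1/2, 1/2, -1/2⟩ ∈ order (-1) 3) ∧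
        u * star u = 1 ∧ moebius (rho (-1) 3 (by norm_num) (castQ (-1) 3 u)) τ = τ} =
    Nat.card {u : ℍ[ℚ,((-1 : ℤ) : ℚ),((3 : ℤ) : ℚ)] // (u ∈ order (-1) 3 ∨ u - ⟨1/2, 1/2, 1/2, -1/2⟩ ∈ order (-1) 3) ∧
        ((u * star u).re = 1 ∨ (u * star u).re = -1) ∧ u * X = X * u} := by
  obtain ⟨p, rfl, hpQ⟩ := exists_eq_mk_of_mem_order_re_zero hX hre
  have hQ : 0 < p.1 ^ 2 - 3 * p.2.1 ^ 2 - 3 * p.2.2 ^ 2 := by exact_mod_cast hpQ.symm ▸ ht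
  have hp0 : (![p.1, p.2.1, p.2.2] : Fin 3 → ℤ) ≠ 0 := by
    intro h
    have h1 : p.1 = 0 := by simpa using congrFun h 0
    have h2 : p.2.1 = 0 := by simpa using congrFun h 1
    have h3 : p.2.2 = 0 := by simpa using congrFun h 2
    rw [h1, h2, h3] at hQ
    norm_num at hQ
  have hQ' : 0 ≤ ((![p.1, p.2.1, p.2.2] : Fin 3 → ℤ) 0 ^ 2 - 3 * (![p.1, p.2.1, p.2.2] : Fin 3 → ℤ) 1 ^ 2 - 3 * (![p.1, p.2.1, p.2.2] : Fin 3 → ℤ) 2 ^ 2) := by rw [fin_normForm₄₁]; exact hQ.le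
  refine Nat.card_congr (Equiv.subtypeEquivRight fun u ↦ ?_)
  constructor
  · rintro ⟨hm, h1, hf⟩
    have hn : (u * star u).re = 1 := by rw [h1, QuaternionAlgebra.re_one]
    exact ⟨hm, Or.inl hn, (commute_iff_moebius_eq_of_special (a := -1) (b := 3) (by norm_num) (by norm_num) hτ.ne' hre ht
      hfix u (by rw [hn]; exact one_ne_zero)).2 hf⟩
  · rintro ⟨hm, hn, hc⟩
    have hn1 : (u * star u).re = 1 :=
      unitStab_norm_eq_one hp0 hQ' hn (by rw [fin_pureVec₄₁]; exact hc)
    exact ⟨hm, mul_star_eq_one_of_re hn1, (commute_iff_moebius_eq_of_special (a := -1) (b := 3) (by norm_num) (by norm_num)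
      hτ.ne' hre ht hfix u (by rw [hn1]; exact one_ne_zero)).1 hc⟩

/-- **`|Γ₆,τ| = |Γ₆,τ'|` for `Γ₆`-equivalent special points** (`t > 0`): if `v ∈ Γ₆` carries `τ` to `τ'`, the vectors `x, x'`
(norm `t`) fixing them satisfy `vx̂v⁻¹ = ±x̂'` (the bridge `conj_eq_or_eq_neg_of_moebius_eq`), so `|Γ₆,τ| = e_x = e_{±x'} =
|Γ₆,τ'|` — the weight of a point of `Z(t)` on `X₆` is well defined. [cite: KudlaRapoportYang2006, §3.2 Prop. 3.2.1 and §3.4 (3.4.11), (3.4.14)] -/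
theorem card_pointStab_eq_of_rel {t : ℤ} (ht : 0 < t) (p q : {τ : ℂ // 0 < τ.im ∧ ∃ x : ℍ[ℚ,((-1 : ℤ) : ℚ),((3 : ℤ) : ℚ)],
        x ∈ order (-1) 3 ∧ x.re = 0 ∧ (x * star x).re = t ∧ moebius (rho (-1) 3 (by norm_num) (castQ (-1) 3 x)) τ = τ})
    (h : ∃ v : ℍ[ℚ,((-1 : ℤ) : ℚ),((3 : ℤ) : ℚ)], (v ∈ order (-1) 3 ∨ v - ⟨1/2, 1/2, 1/2, -1/2⟩ ∈ order (-1) 3) ∧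
        v * star v = 1 ∧ moebius (rho (-1) 3 (by norm_num) (castQ (-1) 3 v)) p.1 = q.1) :
    Nat.card {u : ℍ[ℚ,((-1 : ℤ) : ℚ),((3 : ℤ) : ℚ)] // (u ∈ order (-1) 3 ∨ u - ⟨1/2, 1/2, 1/2, -1/2⟩ ∈ order (-1) 3) ∧
        u * star u = 1 ∧ moebius (rho (-1) 3 (by norm_num) (castQ (-1) 3 u)) p.1 = p.1} =
    Nat.card {u : ℍ[ℚ,((-1 : ℤ) : ℚ),((3 : ℤ) : ℚ)] // (u ∈ order (-1) 3 ∨ u - ⟨1/2, 1/2, 1/2, -1/2⟩ ∈ order (-1) 3) ∧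
        u * star u = 1 ∧ moebius (rho (-1) 3 (by norm_num) (castQ (-1) 3 u)) q.1 = q.1} := by
  obtain ⟨τ, hτ, x, hx, hre, hn, hfix⟩ := p
  obtain ⟨τ', hτ', x', hx', hre', hn', hfix'⟩ := q
  obtain ⟨v, hv, hv1, hvz⟩ := h
  dsimp only at hvz ⊢
  have htx : 0 < (x * star x).re := by rw [hn]; exact_mod_cast ht
  have htx' : 0 < (x' * star x').re := by rw [hn']; exact_mod_cast ht
  rw [card_pointStab_eq_card_unitStab hx hre htx hτ hfix, card_pointStab_eq_card_unitStab hx' hre' htx' hτ' hfix']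
  have hvn : ((v * star v).re = 1 ∨ (v * star v).re = -1) := Or.inl (by rw [hv1, QuaternionAlgebra.re_one])
  rcases conj_eq_or_eq_neg_of_moebius_eq hv1 hre hre' (by rw [hn, hn']) htx' hτ.ne' hτ'.ne' hfix hfix' hvz with hc | hc
  · exact card_unitStab_eq_of_conj (QuaternionAlgebra.star_eq_neg.mpr hre) (QuaternionAlgebra.star_eq_neg.mpr hre') hv hvn hc
  · rw [card_unitStab_eq_of_conj (QuaternionAlgebra.star_eq_neg.mpr hre)
      (by rw [star_neg, QuaternionAlgebra.star_eq_neg.mpr hre']) hv hvn hc]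
    exact card_unitStab_neg _

/-- **`|Γ₆,τ| ∈ {2, 4, 6}` for every special point** (`t > 0`): `= e_x` for the vector `x̂ = c·p̂` fixing `τ`, which is `4`,
`6`, `2` according as `Q(p̂) = 1` (order-`2` elliptic points, `ℤ[i]^×`), `Q(p̂) = 3` (order-`3`, `ℤ[ζ₃]^×`), or else (`±1`).
[cite: KudlaRapoportYang2006, §3.4 (3.4.6) («`w(c²d)`») and (3.4.14)] [cite: BayerTravesa2007, §1 Thm. 1.1] -/
theorem card_pointStab_eq_two_or_four_or_six {t : ℤ} (ht : 0 < t) (p : {τ : ℂ // 0 < τ.im ∧ ∃ x : ℍ[ℚ,((-1 : ℤ) : ℚ),((3 : ℤ) : ℚ)],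
        x ∈ order (-1) 3 ∧ x.re = 0 ∧ (x * star x).re = t ∧ moebius (rho (-1) 3 (by norm_num) (castQ (-1) 3 x)) τ = τ}) :
    Nat.card {u : ℍ[ℚ,((-1 : ℤ) : ℚ),((3 : ℤ) : ℚ)] // (u ∈ order (-1) 3 ∨ u - ⟨1/2, 1/2, 1/2, -1/2⟩ ∈ order (-1) 3) ∧
        u * star u = 1 ∧ moebius (rho (-1) 3 (by norm_num) (castQ (-1) 3 u)) p.1 = p.1} = 2 ∨
    Nat.card {u : ℍ[ℚ,((-1 : ℤ) : ℚ),((3 : ℤ) : ℚ)] // (u ∈ order (-1) 3 ∨ u - ⟨1/2, 1/2, 1/2, -1/2⟩ ∈ order (-1) 3) ∧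
        u * star u = 1 ∧ moebius (rho (-1) 3 (by norm_num) (castQ (-1) 3 u)) p.1 = p.1} = 4 ∨
    Nat.card {u : ℍ[ℚ,((-1 : ℤ) : ℚ),((3 : ℤ) : ℚ)] // (u ∈ order (-1) 3 ∨ u - ⟨1/2, 1/2, 1/2, -1/2⟩ ∈ order (-1) 3) ∧
        u * star u = 1 ∧ moebius (rho (-1) 3 (by norm_num) (castQ (-1) 3 u)) p.1 = p.1} = 6 := by
  obtain ⟨τ, hτ, x, hx, hre, hn, hfix⟩ := p
  dsimp only
  have htx : 0 < (x * star x).re := by rw [hn]; exact_mod_cast ht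
  rw [card_pointStab_eq_card_unitStab hx hre htx hτ hfix]
  obtain ⟨c, q, hc, hq, hxe, hQ⟩ := special_eq_content_smul_primitive_norm hx hre hn ht.ne'
  have hcq : (c : ℚ) ≠ 0 := by positivity
  generalize hQq : (q 0 ^ 2 - 3 * q 1 ^ 2 - 3 * q 2 ^ 2) = Q at hQ
  have hQ0 : 0 < Q := pos_of_mul_pos_right (by rw [hQ]; exact ht) (sq_nonneg _)
  by_cases h1 : Q = 1
  · exact Or.inr (Or.inl (card_unitStab_eq_four hcq hq hxe (by rw [hQq, h1])))
  · by_cases h3 : Q = 3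
    · exact Or.inr (Or.inr (card_unitStab_eq_six hcq hq hxe (by rw [hQq, h3])))
    · exact Or.inl (card_unitStab_eq_two hcq hq hxe (by rw [hQq]; omega) (by rw [hQq]; exact h3))

/-- **`|Γ₆,τ|` at a representative**: for a class `[p] ∈ Pt(t)/Γ₆` (`t > 0`), the stabiliser order at (the point of)
`Quot.out [p]` is that at `p`. [cite: KudlaRapoportYang2006, §3.4 (3.4.11) and (3.4.14)] -/
theorem card_pointStab_mk_out {t : ℤ} (ht : 0 < t) (p : {τ : ℂ // 0 < τ.im ∧ ∃ x : ℍ[ℚ,((-1 : ℤ) : ℚ),((3 : ℤ) : ℚ)],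
        x ∈ order (-1) 3 ∧ x.re = 0 ∧ (x * star x).re = t ∧ moebius (rho (-1) 3 (by norm_num) (castQ (-1) 3 x)) τ = τ}) :
    Nat.card {u : ℍ[ℚ,((-1 : ℤ) : ℚ),((3 : ℤ) : ℚ)] // (u ∈ order (-1) 3 ∨ u - ⟨1/2, 1/2, 1/2, -1/2⟩ ∈ order (-1) 3) ∧
        u * star u = 1 ∧ moebius (rho (-1) 3 (by norm_num) (castQ (-1) 3 u)) ((Quot.mk _ p : (Quot (fun p q : {τ : ℂ // 0 < τ.im ∧ ∃ x : ℍ[ℚ,((-1 : ℤ) : ℚ),((3 : ℤ) : ℚ)],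
        x ∈ order (-1) 3 ∧ x.re = 0 ∧ (x * star x).re = t ∧ moebius (rho (-1) 3 (by norm_num) (castQ (-1) 3 x)) τ = τ} ↦
      ∃ v : ℍ[ℚ,((-1 : ℤ) : ℚ),((3 : ℤ) : ℚ)], (v ∈ order (-1) 3 ∨ v - ⟨1/2, 1/2, 1/2, -1/2⟩ ∈ order (-1) 3) ∧
        v * star v = 1 ∧ moebius (rho (-1) 3 (by norm_num) (castQ (-1) 3 v)) p.1 = q.1))).out).1 = ((Quot.mk _ p : (Quot (fun p q : {τ : ℂ // 0 < τ.im ∧ ∃ x : ℍ[ℚ,((-1 : ℤ) : ℚ),((3 : ℤ) : ℚ)],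
        x ∈ order (-1) 3 ∧ x.re = 0 ∧ (x * star x).re = t ∧ moebius (rho (-1) 3 (by norm_num) (castQ (-1) 3 x)) τ = τ} ↦
      ∃ v : ℍ[ℚ,((-1 : ℤ) : ℚ),((3 : ℤ) : ℚ)], (v ∈ order (-1) 3 ∨ v - ⟨1/2, 1/2, 1/2, -1/2⟩ ∈ order (-1) 3) ∧
        v * star v = 1 ∧ moebius (rho (-1) 3 (by norm_num) (castQ (-1) 3 v)) p.1 = q.1))).out).1} =
    Nat.card {u : ℍ[ℚ,((-1 : ℤ) : ℚ),((3 : ℤ) : ℚ)] // (u ∈ order (-1) 3 ∨ u - ⟨1/2, 1/2, 1/2, -1/2⟩ ∈ order (-1) 3) ∧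
        u * star u = 1 ∧ moebius (rho (-1) 3 (by norm_num) (castQ (-1) 3 u)) p.1 = p.1} :=
  card_pointStab_eq_of_rel ht _ _ ((specialPoints_mk_eq_iff t _ p).1 (Quot.out_eq (Quot.mk _ p : (Quot (fun p q : {τ : ℂ // 0 < τ.im ∧ ∃ x : ℍ[ℚ,((-1 : ℤ) : ℚ),((3 : ℤ) : ℚ)],
        x ∈ order (-1) 3 ∧ x.re = 0 ∧ (x * star x).re = t ∧ moebius (rho (-1) 3 (by norm_num) (castQ (-1) 3 x)) τ = τ} ↦
      ∃ v : ℍ[ℚ,((-1 : ℤ) : ℚ),((3 : ℤ) : ℚ)], (v ∈ order (-1) 3 ∨ v - ⟨1/2, 1/2, 1/2, -1/2⟩ ∈ order (-1) 3) ∧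
        v * star v = 1 ∧ moebius (rho (-1) 3 (by norm_num) (castQ (-1) 3 v)) p.1 = q.1)))))

end Stabiliser

/-! ## §2 The weighted two-to-one map `[x̂] ↦ [z_x]`: `deg Z(t)_ℚ = 2·Σᶠ_{[τ] ∈ Pt(t)/Γ₆} |Γ₆,τ|⁻¹` -/

section Mass

/-- **`Σᶠ_{[x] ∈ L(t)/Γ₆} e_x⁻¹ = 2·Σᶠ_{[τ] ∈ Pt(t)/Γ₆} |Γ₆,τ|⁻¹` FOR EVERY `t > 0`** — the map `[x̂] ↦ [z_x]` (`z_x` the fixed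
point of `ρ(x̂)` in `ℌ`) is a two-sheeted cover `L(t)/Γ₆ → Pt(t)/Γ₆` with fibres `{[x̂], [−x̂]}` (`z_{−x} = z_x`; «`−x ∉ Γ·x`»;
the bridge `[z_x] = [z_y] ⟹ vx̂v⁻¹ = ±ŷ`), exactly as in `card_normOne_classes_eq_two_mul_card_specialPoints`, and the weights
agree along it: `e_x = e_{−x} = |Γ₆,z_x|` (`card_pointStab_eq_card_unitStab`). [cite: KudlaRapoportYang2006, §3.4 (3.4.9)–(3.4.14), Lemma 3.4.3 and Remark 3.4.4] [cite: VignerasLNM800, Ch. IV §1] -/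
theorem finsum_normOne_classes_eq_two_mul_finsum_points {t : ℤ} (ht : 0 < t) :
    ∑ᶠ q : (Quot (fun x y : {x : ℤ × ℤ × ℤ // x.1 ^ 2 - 3 * x.2.1 ^ 2 - 3 * x.2.2 ^ 2 = t} ↦
      ∃ u : ℍ[ℚ,((-1 : ℤ) : ℚ),((3 : ℤ) : ℚ)], (u ∈ order (-1) 3 ∨ u - ⟨1/2, 1/2, 1/2, -1/2⟩ ∈ order (-1) 3) ∧
        (u * star u).re = 1 ∧ u * ⟨0, x.1.1, x.1.2.1, x.1.2.2⟩ = ⟨0, y.1.1, y.1.2.1, y.1.2.2⟩ * u)),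
        ((Nat.card
          {u : ℍ[ℚ,((-1 : ℤ) : ℚ),((3 : ℤ) : ℚ)] // (u ∈ order (-1) 3 ∨ u - ⟨1/2, 1/2, 1/2, -1/2⟩ ∈ order (-1) 3) ∧
            ((u * star u).re = 1 ∨ (u * star u).re = -1) ∧
            u * ⟨0, q.out.1.1, q.out.1.2.1, q.out.1.2.2⟩ = ⟨0, q.out.1.1, q.out.1.2.1, q.out.1.2.2⟩ * u} : ℚ))⁻¹ =
    2 * ∑ᶠ P : (Quot (fun p q : {τ : ℂ // 0 < τ.im ∧ ∃ x : ℍ[ℚ,((-1 : ℤ) : ℚ),((3 : ℤ) : ℚ)],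
        x ∈ order (-1) 3 ∧ x.re = 0 ∧ (x * star x).re = t ∧ moebius (rho (-1) 3 (by norm_num) (castQ (-1) 3 x)) τ = τ} ↦
      ∃ v : ℍ[ℚ,((-1 : ℤ) : ℚ),((3 : ℤ) : ℚ)], (v ∈ order (-1) 3 ∨ v - ⟨1/2, 1/2, 1/2, -1/2⟩ ∈ order (-1) 3) ∧
        v * star v = 1 ∧ moebius (rho (-1) 3 (by norm_num) (castQ (-1) 3 v)) p.1 = q.1)),
        ((Nat.card
          {u : ℍ[ℚ,((-1 : ℤ) : ℚ),((3 : ℤ) : ℚ)] // (u ∈ order (-1) 3 ∨ u - ⟨1/2, 1/2, 1/2, -1/2⟩ ∈ order (-1) 3) ∧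
            u * star u = 1 ∧ moebius (rho (-1) 3 (by norm_num) (castQ (-1) 3 u)) P.out.1 = P.out.1} : ℚ))⁻¹ := by
  have hfin := finite_normOne_classes ht
  set R : {x : ℤ × ℤ × ℤ // x.1 ^ 2 - 3 * x.2.1 ^ 2 - 3 * x.2.2 ^ 2 = t} → {x : ℤ × ℤ × ℤ // x.1 ^ 2 - 3 * x.2.1 ^ 2 - 3 * x.2.2 ^ 2 = t} → Prop := (fun x y : {x : ℤ × ℤ × ℤ // x.1 ^ 2 - 3 * x.2.1 ^ 2 - 3 * x.2.2 ^ 2 = t} ↦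
      ∃ u : ℍ[ℚ,((-1 : ℤ) : ℚ),((3 : ℤ) : ℚ)], (u ∈ order (-1) 3 ∨ u - ⟨1/2, 1/2, 1/2, -1/2⟩ ∈ order (-1) 3) ∧
        (u * star u).re = 1 ∧ u * ⟨0, x.1.1, x.1.2.1, x.1.2.2⟩ = ⟨0, y.1.1, y.1.2.1, y.1.2.2⟩ * u) with hR
  set S : {τ : ℂ // 0 < τ.im ∧ ∃ x : ℍ[ℚ,((-1 : ℤ) : ℚ),((3 : ℤ) : ℚ)],
        x ∈ order (-1) 3 ∧ x.re = 0 ∧ (x * star x).re = t ∧ moebius (rho (-1) 3 (by norm_num) (castQ (-1) 3 x)) τ = τ} → {τ : ℂ // 0 < τ.im ∧ ∃ x : ℍ[ℚ,((-1 : ℤ) : ℚ),((3 : ℤ) : ℚ)],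
        x ∈ order (-1) 3 ∧ x.re = 0 ∧ (x * star x).re = t ∧ moebius (rho (-1) 3 (by norm_num) (castQ (-1) 3 x)) τ = τ} → Prop := (fun p q : {τ : ℂ // 0 < τ.im ∧ ∃ x : ℍ[ℚ,((-1 : ℤ) : ℚ),((3 : ℤ) : ℚ)],
        x ∈ order (-1) 3 ∧ x.re = 0 ∧ (x * star x).re = t ∧ moebius (rho (-1) 3 (by norm_num) (castQ (-1) 3 x)) τ = τ} ↦
      ∃ v : ℍ[ℚ,((-1 : ℤ) : ℚ),((3 : ℤ) : ℚ)], (v ∈ order (-1) 3 ∨ v - ⟨1/2, 1/2, 1/2, -1/2⟩ ∈ order (-1) 3) ∧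
        v * star v = 1 ∧ moebius (rho (-1) 3 (by norm_num) (castQ (-1) 3 v)) p.1 = q.1) with hS
  haveI : Finite (Quot R) := hfin
  have hE : Equivalence R := normOne_conj_equivalence t
  have hiff : ∀ x y, Quot.mk R x = Quot.mk R y ↔ R x y := normOne_conj_mk_eq_iff t
  have hiffS : ∀ p q, Quot.mk S p = Quot.mk S q ↔ S p q := specialPoints_mk_eq_iff t
  -- the special vector of `x` and its fixed point `z_x ∈ ℌ`
  have hnorm : ∀ x : {x : ℤ × ℤ × ℤ // x.1 ^ 2 - 3 * x.2.1 ^ 2 - 3 * x.2.2 ^ 2 = t}, ((⟨0, x.1.1, x.1.2.1, x.1.2.2⟩ : ℍ[ℚ,((-1 : ℤ) : ℚ),((3 : ℤ) : ℚ)]) * star ⟨0, x.1.1, x.1.2.1, x.1.2.2⟩).re = t := by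
    intro x
    have hx : x.1.1 ^ 2 - 3 * x.1.2.1 ^ 2 - 3 * x.1.2.2 ^ 2 = t := x.2
    rw [pureVec_norm]; exact_mod_cast hx
  have hpos : ∀ x : {x : ℤ × ℤ × ℤ // x.1 ^ 2 - 3 * x.2.1 ^ 2 - 3 * x.2.2 ^ 2 = t}, 0 < ((⟨0, x.1.1, x.1.2.1, x.1.2.2⟩ : ℍ[ℚ,((-1 : ℤ) : ℚ),((3 : ℤ) : ℚ)]) * star ⟨0, x.1.1, x.1.2.1, x.1.2.2⟩).re := by
    intro x; rw [hnorm x]; exact_mod_cast ht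
  have hmem : ∀ x : {x : ℤ × ℤ × ℤ // x.1 ^ 2 - 3 * x.2.1 ^ 2 - 3 * x.2.2 ^ 2 = t}, (⟨0, x.1.1, x.1.2.1, x.1.2.2⟩ : ℍ[ℚ,((-1 : ℤ) : ℚ),((3 : ℤ) : ℚ)]) ∈ order (-1) 3 := fun x ↦
    ⟨![0, x.1.1, x.1.2.1, x.1.2.2], by ext <;> simp [ofCoords]⟩
  have hfp : ∀ x : {x : ℤ × ℤ × ℤ // x.1 ^ 2 - 3 * x.2.1 ^ 2 - 3 * x.2.2 ^ 2 = t}, ∃ τ : UpperHalfPlane, moebius (rho (-1) 3 (by norm_num) (castQ (-1) 3 (⟨0, x.1.1, x.1.2.1, x.1.2.2⟩ : ℍ[ℚ,((-1 : ℤ) : ℚ),((3 : ℤ) : ℚ)]))) (τ : ℂ) = τ := fun x ↦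
    (existsUnique_fixedPoint_of_special (by norm_num) rfl (hpos x)).exists
  choose z hz using hfp
  -- the point of `x`
  set pt : {x : ℤ × ℤ × ℤ // x.1 ^ 2 - 3 * x.2.1 ^ 2 - 3 * x.2.2 ^ 2 = t} → {τ : ℂ // 0 < τ.im ∧ ∃ x : ℍ[ℚ,((-1 : ℤ) : ℚ),((3 : ℤ) : ℚ)],
        x ∈ order (-1) 3 ∧ x.re = 0 ∧ (x * star x).re = t ∧ moebius (rho (-1) 3 (by norm_num) (castQ (-1) 3 x)) τ = τ} :=
    fun x ↦ ⟨(z x : ℂ), (z x).2, ⟨0, x.1.1, x.1.2.1, x.1.2.2⟩, hmem x, rfl, hnorm x, hz x⟩ with hpt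
  -- the sign map on vectors
  set ng : {x : ℤ × ℤ × ℤ // x.1 ^ 2 - 3 * x.2.1 ^ 2 - 3 * x.2.2 ^ 2 = t} → {x : ℤ × ℤ × ℤ // x.1 ^ 2 - 3 * x.2.1 ^ 2 - 3 * x.2.2 ^ 2 = t} :=
    fun x ↦ ⟨(-x.1.1, -x.1.2.1, -x.1.2.2), by
      show (-x.1.1) ^ 2 - 3 * (-x.1.2.1) ^ 2 - 3 * (-x.1.2.2) ^ 2 = t; linear_combination x.2⟩ with hng
  have cng : ∀ x y, R x y → R (ng x) (ng y) := by
    rintro x y ⟨u, hu, hn, h⟩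
    simp only [hR, hng]
    refine ⟨u, hu, hn, ?_⟩
    rw [neg_pureVec₄₁, neg_pureVec₄₁, mul_neg, neg_mul, h]
  -- `z` is compatible with `Γ₆`-conjugation and with the sign
  have hzconj : ∀ x y : {x : ℤ × ℤ × ℤ // x.1 ^ 2 - 3 * x.2.1 ^ 2 - 3 * x.2.2 ^ 2 = t}, ∀ u : ℍ[ℚ,((-1 : ℤ) : ℚ),((3 : ℤ) : ℚ)], u * star u = 1 →
      u * ⟨0, x.1.1, x.1.2.1, x.1.2.2⟩ = ⟨0, y.1.1, y.1.2.1, y.1.2.2⟩ * u → moebius (rho (-1) 3 (by norm_num) (castQ (-1) 3 u)) (z x : ℂ) = z y := by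
    intro x y u hu1 h
    have h3 : (0 : ℤ) < 3 := by norm_num
    have hun : (u * star u).re ≠ 0 := by rw [hu1, QuaternionAlgebra.re_one]; exact one_ne_zero
    have hfix := moebius_conj_fixed_of_im_ne_zero h3 (ε := u) (x := (⟨0, x.1.1, x.1.2.1, x.1.2.2⟩ : ℍ[ℚ,((-1 : ℤ) : ℚ),((3 : ℤ) : ℚ)])) hun (z x).2.ne' (hz x)
    rw [h, mul_assoc, hu1, mul_one] at hfix
    exact fixed_unique₄₁ rfl (hpos y) (im_moebius_rho_pos (by norm_num) (by rw [hu1, QuaternionAlgebra.re_one]; exact one_pos) (z x).2)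
      (z y).2 hfix (hz y)
  have hzneg : ∀ x : {x : ℤ × ℤ × ℤ // x.1 ^ 2 - 3 * x.2.1 ^ 2 - 3 * x.2.2 ^ 2 = t}, (z (ng x) : ℂ) = z x := by
    intro x
    refine fixed_unique₄₁ rfl (hpos x) (z (ng x)).2 (z x).2 ?_ (hz x)
    have h := hz (ng x)
    simp only [hng] at h
    rwa [neg_pureVec₄₁, moebius_rho_castQ_neg] at h
  -- the map on classes
  have hlift : ∀ x y, R x y → Quot.mk S (pt x) = Quot.mk S (pt y) := by
    rintro x y ⟨u, hu, hn, h⟩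
    rw [hiffS]
    exact ⟨u, hu, mul_star_eq_one_of_re hn, hzconj x y u (mul_star_eq_one_of_re hn) h⟩
  let f : Quot R → Quot S := Quot.lift (fun x ↦ Quot.mk S (pt x)) hlift
  -- the weights agree along `f`
  have hout : ∀ x : {x : ℤ × ℤ × ℤ // x.1 ^ 2 - 3 * x.2.1 ^ 2 - 3 * x.2.2 ^ 2 = t}, Nat.card {u : ℍ[ℚ,((-1 : ℤ) : ℚ),((3 : ℤ) : ℚ)] // (u ∈ order (-1) 3 ∨ u - ⟨1/2, 1/2, 1/2, -1/2⟩ ∈ order (-1) 3) ∧ ((u * star u).re = 1 ∨ (u * star u).re = -1) ∧ u * (⟨0, ((Quot.mk R x).out).1.1, ((Quot.mk R x).out).1.2.1, ((Quot.mk R x).out).1.2.2⟩ : ℍ[ℚ,((-1 : ℤ) : ℚ),((3 : ℤ) : ℚ)]) = (⟨0, ((Quot.mk R x).out).1.1, ((Quot.mk R x).out).1.2.1, ((Quot.mk R x).out).1.2.2⟩ : ℍ[ℚ,((-1 : ℤ) : ℚ),((3 : ℤ) : ℚ)]) * u} =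
      Nat.card {u : ℍ[ℚ,((-1 : ℤ) : ℚ),((3 : ℤ) : ℚ)] // (u ∈ order (-1) 3 ∨ u - ⟨1/2, 1/2, 1/2, -1/2⟩ ∈ order (-1) 3) ∧ ((u * star u).re = 1 ∨ (u * star u).re = -1) ∧ u * (⟨0, x.1.1, x.1.2.1, x.1.2.2⟩ : ℍ[ℚ,((-1 : ℤ) : ℚ),((3 : ℤ) : ℚ)]) = (⟨0, x.1.1, x.1.2.1, x.1.2.2⟩ : ℍ[ℚ,((-1 : ℤ) : ℚ),((3 : ℤ) : ℚ)]) * u} := card_unitStab_normOne_mk_out t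
  have houtS : ∀ p : {τ : ℂ // 0 < τ.im ∧ ∃ x : ℍ[ℚ,((-1 : ℤ) : ℚ),((3 : ℤ) : ℚ)],
        x ∈ order (-1) 3 ∧ x.re = 0 ∧ (x * star x).re = t ∧ moebius (rho (-1) 3 (by norm_num) (castQ (-1) 3 x)) τ = τ}, Nat.card {u : ℍ[ℚ,((-1 : ℤ) : ℚ),((3 : ℤ) : ℚ)] // (u ∈ order (-1) 3 ∨ u - ⟨1/2, 1/2, 1/2, -1/2⟩ ∈ order (-1) 3) ∧ u * star u = 1 ∧ moebius (rho (-1) 3 (by norm_num) (castQ (-1) 3 u)) ((Quot.mk S p).out).1 = ((Quot.mk S p).out).1} = Nat.card {u : ℍ[ℚ,((-1 : ℤ) : ℚ),((3 : ℤ) : ℚ)] // (u ∈ order (-1) 3 ∨ u - ⟨1/2, 1/2, 1/2, -1/2⟩ ∈ order (-1) 3) ∧ u * star u = 1 ∧ moebius (rho (-1) 3 (by norm_num) (castQ (-1) 3 u)) p.1 = p.1} := card_pointStab_mk_out ht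
  have hcongr : ∀ q : Quot R, ((Nat.card
          {u : ℍ[ℚ,((-1 : ℤ) : ℚ),((3 : ℤ) : ℚ)] // (u ∈ order (-1) 3 ∨ u - ⟨1/2, 1/2, 1/2, -1/2⟩ ∈ order (-1) 3) ∧
            ((u * star u).re = 1 ∨ (u * star u).re = -1) ∧
            u * ⟨0, q.out.1.1, q.out.1.2.1, q.out.1.2.2⟩ = ⟨0, q.out.1.1, q.out.1.2.1, q.out.1.2.2⟩ * u} : ℚ))⁻¹ =
      (fun P : Quot S ↦ ((Nat.card
          {u : ℍ[ℚ,((-1 : ℤ) : ℚ),((3 : ℤ) : ℚ)] // (u ∈ order (-1) 3 ∨ u - ⟨1/2, 1/2, 1/2, -1/2⟩ ∈ order (-1) 3) ∧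
            u * star u = 1 ∧ moebius (rho (-1) 3 (by norm_num) (castQ (-1) 3 u)) P.out.1 = P.out.1} : ℚ))⁻¹) (f q) := by
    intro q
    induction q using Quot.ind with
    | _ x =>
      show ((Nat.card {u : ℍ[ℚ,((-1 : ℤ) : ℚ),((3 : ℤ) : ℚ)] // (u ∈ order (-1) 3 ∨ u - ⟨1/2, 1/2, 1/2, -1/2⟩ ∈ order (-1) 3) ∧ ((u * star u).re = 1 ∨ (u * star u).re = -1) ∧ u * (⟨0, ((Quot.mk R x).out).1.1, ((Quot.mk R x).out).1.2.1, ((Quot.mk R x).out).1.2.2⟩ : ℍ[ℚ,((-1 : ℤ) : ℚ),((3 : ℤ) : ℚ)]) = (⟨0, ((Quot.mk R x).out).1.1, ((Quot.mk R x).out).1.2.1, ((Quot.mk R x).out).1.2.2⟩ : ℍ[ℚ,((-1 : ℤ) : ℚ),((3 : ℤ) : ℚ)]) * u} : ℚ))⁻¹ =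
        ((Nat.card {u : ℍ[ℚ,((-1 : ℤ) : ℚ),((3 : ℤ) : ℚ)] // (u ∈ order (-1) 3 ∨ u - ⟨1/2, 1/2, 1/2, -1/2⟩ ∈ order (-1) 3) ∧ u * star u = 1 ∧ moebius (rho (-1) 3 (by norm_num) (castQ (-1) 3 u)) ((Quot.mk S (pt x)).out).1 = ((Quot.mk S (pt x)).out).1} : ℚ))⁻¹
      rw [hout, houtS]
      show ((Nat.card {u : ℍ[ℚ,((-1 : ℤ) : ℚ),((3 : ℤ) : ℚ)] // (u ∈ order (-1) 3 ∨ u - ⟨1/2, 1/2, 1/2, -1/2⟩ ∈ order (-1) 3) ∧ ((u * star u).re = 1 ∨ (u * star u).re = -1) ∧ u * (⟨0, x.1.1, x.1.2.1, x.1.2.2⟩ : ℍ[ℚ,((-1 : ℤ) : ℚ),((3 : ℤ) : ℚ)]) = (⟨0, x.1.1, x.1.2.1, x.1.2.2⟩ : ℍ[ℚ,((-1 : ℤ) : ℚ),((3 : ℤ) : ℚ)]) * u} : ℚ))⁻¹ = ((Nat.card {u : ℍ[ℚ,((-1 : ℤ) : ℚ),((3 : ℤ) : ℚ)] // (u ∈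 order (-1) 3 ∨ u - ⟨1/2, 1/2, 1/2, -1/2⟩ ∈ order (-1) 3) ∧ u * star u = 1 ∧ moebius (rho (-1) 3 (by norm_num) (castQ (-1) 3 u)) (z x : ℂ) = (z x : ℂ)} : ℚ))⁻¹
      rw [card_pointStab_eq_card_unitStab (hmem x) rfl (hpos x) (z x).2 (hz x)]
  have hπ : ∀ q : Quot R, Quot.map ng cng q ≠ q := by
    -- `[−x] ≠ [x]`
    intro q
    induction q using Quot.ind with
    | _ x =>
      show Quot.mk R (ng x) ≠ Quot.mk R x
      rw [Ne, hiff]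
      simp only [hR, hng]
      rintro ⟨u, hu, hn, h⟩
      rw [neg_pureVec₄₁, mul_neg] at h
      have hQx : 0 < x.1.1 ^ 2 - 3 * x.1.2.1 ^ 2 - 3 * x.1.2.2 ^ 2 := by
        have hx : x.1.1 ^ 2 - 3 * x.1.2.1 ^ 2 - 3 * x.1.2.2 ^ 2 = t := x.2
        rw [hx]; exact ht
      have q4 := e_quadruple_pairwise_not_normOne_conj ![x.1.1, x.1.2.1, x.1.2.2] (by simpa using hQx) hn
      simp only [Matrix.cons_val_zero, Matrix.cons_val_one, Matrix.cons_val_two, Matrix.head_cons, Matrix.tail_cons] at q4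
      exact q4.2.2.1 (by rw [neg_mul, ← h, neg_neg])
  have hf : Function.Surjective f := by
    -- onto: a point fixed by `x ∈ 𝔬`, `tr x = 0`, `nr x = t` is `z_x`
    intro q
    induction q using Quot.ind with
    | _ p =>
      obtain ⟨τ, hτ, x, hx, hre, hn, hfix⟩ := p
      obtain ⟨⟨p₁, p₂, p₃⟩, hpe, hpQ⟩ := exists_eq_mk_of_mem_order_re_zero hx hre
      dsimp only at hpe hpQ
      rw [hn] at hpQ
      have hQ : p₁ ^ 2 - 3 * p₂ ^ 2 - 3 * p₃ ^ 2 = t := by exact_mod_cast hpQ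
      refine ⟨Quot.mk R ⟨(p₁, p₂, p₃), hQ⟩, ?_⟩
      show Quot.mk S (pt ⟨(p₁, p₂, p₃), hQ⟩) = Quot.mk S _
      rw [hiffS]
      refine ⟨1, Or.inl (Subring.one_mem _), by rw [star_one, mul_one], ?_⟩
      rw [moebius_rho_castQ_one₄₁]
      show (z ⟨(p₁, p₂, p₃), hQ⟩ : ℂ) = τ
      refine fixed_unique₄₁ rfl (hpos ⟨(p₁, p₂, p₃), hQ⟩) (z _).2 hτ (hz _) ?_
      show moebius (rho (-1) 3 (by norm_num) (castQ (-1) 3 (⟨0, ((p₁ : ℤ) : ℚ), ((p₂ : ℤ) : ℚ), ((p₃ : ℤ) : ℚ)⟩ : ℍ[ℚ,((-1 : ℤ) : ℚ),((3 : ℤ) : ℚ)]))) τ = τ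
      rw [← hpe]; exact hfix
  have hfπ : ∀ q : Quot R, f (Quot.map ng cng q) = f q := by
    -- `z_{−x} = z_x`
    intro q
    induction q using Quot.ind with
    | _ x =>
      show Quot.mk S (pt (ng x)) = Quot.mk S (pt x)
      rw [hiffS]
      refine ⟨1, Or.inl (Subring.one_mem _), by rw [star_one, mul_one], ?_⟩
      rw [moebius_rho_castQ_one₄₁]
      exact hzneg x
  have hff : ∀ q₁ q₂ : Quot R, f q₁ = f q₂ → q₁ = q₂ ∨ q₁ = Quot.map ng cng q₂ := by
    -- fibres `{[x], [−x]}`: the bridge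
    intro q₁ q₂
    induction q₁ using Quot.ind with
    | _ x₁ =>
      induction q₂ using Quot.ind with
      | _ x₂ =>
        intro h
        change Quot.mk S (pt x₁) = Quot.mk S (pt x₂) at h
        rw [hiffS] at h
        obtain ⟨v, hv, hv1, hvz⟩ := h
        rcases conj_eq_or_eq_neg_of_moebius_eq hv1 rfl rfl (by rw [hnorm x₁, hnorm x₂]) (hpos x₂) (z x₁).2.ne' (z x₂).2.ne'
            (hz x₁) (hz x₂) hvz with hc | hc
        · left
          rw [hiff]
          exact ⟨v, hv, by rw [hv1, QuaternionAlgebra.re_one], hc⟩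
        · right
          show Quot.mk R x₁ = Quot.mk R (ng x₂)
          rw [hiff]
          simp only [hR, hng]
          refine ⟨v, hv, by rw [hv1, QuaternionAlgebra.re_one], ?_⟩
          rw [neg_pureVec₄₁, hc]
  have key := finsum_comp_eq_two_mul_finsum₄₁ (Quot.map ng cng) hπ f hf hfπ hff (fun P : Quot S ↦ ((Nat.card
          {u : ℍ[ℚ,((-1 : ℤ) : ℚ),((3 : ℤ) : ℚ)] // (u ∈ order (-1) 3 ∨ u - ⟨1/2, 1/2, 1/2, -1/2⟩ ∈ order (-1) 3) ∧
            u * star u = 1 ∧ moebius (rho (-1) 3 (by norm_num) (castQ (-1) 3 u)) P.out.1 = P.out.1} : ℚ))⁻¹)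
  have key' := (finsum_congr hcongr).trans key
  exact key'

/-- **`deg Z(t)_ℚ = 2·Σᶠ_{[x] ∈ L(t)/O₆^×} e_x⁻¹ = 2·Σᶠ_{[τ] ∈ Pt(t)/Γ₆} |Γ₆,τ|⁻¹` FOR EVERY `t > 0`** — Kudla–Rapoport–Yang's
degree is the ORBIFOLD MASS `Σ_{P ∈ supp Z(t)} 1/|Γ₆,P/{±1}|` of the support of `Z(t)` on `X₆ = Γ₆∖ℌ` («each point … counted
with multiplicity `1/|Aut|`», the automorphisms being the stabiliser): (3.4.14) through `Σᶠ_{L/Γ₆} e⁻¹ = 2Σᶠ_{L/O₆^×} e⁻¹`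
(`…DegreeStructure`) and the weighted two-to-one map `[x̂] ↦ [z_x]`. [cite: KudlaRapoportYang2006, §3.4 (3.4.13)–(3.4.14) and p. 53; §3.2 Prop. 3.2.1] [cite: VignerasLNM800, Ch. IV §1] -/
theorem degree_eq_two_mul_finsum_points {t : ℤ} (ht : 0 < t) :
    2 * ∑ᶠ q : (Quot (fun x y : {x : ℤ × ℤ × ℤ // x.1 ^ 2 - 3 * x.2.1 ^ 2 - 3 * x.2.2 ^ 2 = t} ↦
      ∃ v : ℍ[ℚ,((-1 : ℤ) : ℚ),((3 : ℤ) : ℚ)], (v ∈ order (-1) 3 ∨ v - ⟨1/2, 1/2, 1/2, -1/2⟩ ∈ order (-1) 3) ∧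
        ((v * star v).re = 1 ∨ (v * star v).re = -1) ∧
        v * ⟨0, x.1.1, x.1.2.1, x.1.2.2⟩ = ⟨0, y.1.1, y.1.2.1, y.1.2.2⟩ * v)),
        ((Nat.card
          {u : ℍ[ℚ,((-1 : ℤ) : ℚ),((3 : ℤ) : ℚ)] // (u ∈ order (-1) 3 ∨ u - ⟨1/2, 1/2, 1/2, -1/2⟩ ∈ order (-1) 3) ∧
            ((u * star u).re = 1 ∨ (u * star u).re = -1) ∧
            u * ⟨0, q.out.1.1, q.out.1.2.1, q.out.1.2.2⟩ = ⟨0, q.out.1.1, q.out.1.2.1, q.out.1.2.2⟩ * u} : ℚ))⁻¹ =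
    2 * ∑ᶠ P : (Quot (fun p q : {τ : ℂ // 0 < τ.im ∧ ∃ x : ℍ[ℚ,((-1 : ℤ) : ℚ),((3 : ℤ) : ℚ)],
        x ∈ order (-1) 3 ∧ x.re = 0 ∧ (x * star x).re = t ∧ moebius (rho (-1) 3 (by norm_num) (castQ (-1) 3 x)) τ = τ} ↦
      ∃ v : ℍ[ℚ,((-1 : ℤ) : ℚ),((3 : ℤ) : ℚ)], (v ∈ order (-1) 3 ∨ v - ⟨1/2, 1/2, 1/2, -1/2⟩ ∈ order (-1) 3) ∧
        v * star v = 1 ∧ moebius (rho (-1) 3 (by norm_num) (castQ (-1) 3 v)) p.1 = q.1)),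
        ((Nat.card
          {u : ℍ[ℚ,((-1 : ℤ) : ℚ),((3 : ℤ) : ℚ)] // (u ∈ order (-1) 3 ∨ u - ⟨1/2, 1/2, 1/2, -1/2⟩ ∈ order (-1) 3) ∧
            u * star u = 1 ∧ moebius (rho (-1) 3 (by norm_num) (castQ (-1) 3 u)) P.out.1 = P.out.1} : ℚ))⁻¹ := by
  rw [← finsum_normOne_classes_eq_two_mul_finsum_unit_classes ht, finsum_normOne_classes_eq_two_mul_finsum_points ht]

/-- **KRY's index set and the points of `X₆` carry the same weights**: `Σᶠ_{[x] ∈ L(t)/O₆^×} e_x⁻¹ = Σᶠ_{[τ] ∈ Pt(t)/Γ₆}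
|Γ₆,τ|⁻¹` (`t > 0`) — refining `|Pt(t)/Γ₆| = |L(t)/O₆^×|` (`card_specialPoints_eq_card_unit_classes`).
[cite: KudlaRapoportYang2006, §3.2 p. 48 and §3.4 (3.4.13)–(3.4.14)] -/
theorem finsum_unit_classes_eq_finsum_points {t : ℤ} (ht : 0 < t) :
    ∑ᶠ q : (Quot (fun x y : {x : ℤ × ℤ × ℤ // x.1 ^ 2 - 3 * x.2.1 ^ 2 - 3 * x.2.2 ^ 2 = t} ↦
      ∃ v : ℍ[ℚ,((-1 : ℤ) : ℚ),((3 : ℤ) : ℚ)], (v ∈ order (-1) 3 ∨ v - ⟨1/2, 1/2, 1/2, -1/2⟩ ∈ order (-1) 3) ∧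
        ((v * star v).re = 1 ∨ (v * star v).re = -1) ∧
        v * ⟨0, x.1.1, x.1.2.1, x.1.2.2⟩ = ⟨0, y.1.1, y.1.2.1, y.1.2.2⟩ * v)),
        ((Nat.card
          {u : ℍ[ℚ,((-1 : ℤ) : ℚ),((3 : ℤ) : ℚ)] // (u ∈ order (-1) 3 ∨ u - ⟨1/2, 1/2, 1/2, -1/2⟩ ∈ order (-1) 3) ∧
            ((u * star u).re = 1 ∨ (u * star u).re = -1) ∧
            u * ⟨0, q.out.1.1, q.out.1.2.1, q.out.1.2.2⟩ = ⟨0, q.out.1.1, q.out.1.2.1, q.out.1.2.2⟩ * u} : ℚ))⁻¹ =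
    ∑ᶠ P : (Quot (fun p q : {τ : ℂ // 0 < τ.im ∧ ∃ x : ℍ[ℚ,((-1 : ℤ) : ℚ),((3 : ℤ) : ℚ)],
        x ∈ order (-1) 3 ∧ x.re = 0 ∧ (x * star x).re = t ∧ moebius (rho (-1) 3 (by norm_num) (castQ (-1) 3 x)) τ = τ} ↦
      ∃ v : ℍ[ℚ,((-1 : ℤ) : ℚ),((3 : ℤ) : ℚ)], (v ∈ order (-1) 3 ∨ v - ⟨1/2, 1/2, 1/2, -1/2⟩ ∈ order (-1) 3) ∧
        v * star v = 1 ∧ moebius (rho (-1) 3 (by norm_num) (castQ (-1) 3 v)) p.1 = q.1)),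
        ((Nat.card
          {u : ℍ[ℚ,((-1 : ℤ) : ℚ),((3 : ℤ) : ℚ)] // (u ∈ order (-1) 3 ∨ u - ⟨1/2, 1/2, 1/2, -1/2⟩ ∈ order (-1) 3) ∧
            u * star u = 1 ∧ moebius (rho (-1) 3 (by norm_num) (castQ (-1) 3 u)) P.out.1 = P.out.1} : ℚ))⁻¹ := by
  have h := degree_eq_two_mul_finsum_points ht
  linarith

/-- **`Σᶠ_{[τ] ∈ Pt(1)/Γ₆} |Γ₆,τ|⁻¹ = 1/2`** — the support of `Z(1)` is the two elliptic points of order `2` of `X₆`, each with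
`|Γ₆,τ| = 4` (`±1, ±i`): `2·¼ = ½`, `deg Z(1)_ℚ = 1`. [cite: KudlaRapoportYang2006, §3.4 (3.4.14)] [cite: BayerTravesa2007, §1 Thm. 1.1] -/
theorem finsum_points_one :
    ∑ᶠ P : (Quot (fun p q : {τ : ℂ // 0 < τ.im ∧ ∃ x : ℍ[ℚ,((-1 : ℤ) : ℚ),((3 : ℤ) : ℚ)],
        x ∈ order (-1) 3 ∧ x.re = 0 ∧ (x * star x).re = ((1 : ℤ) : ℚ) ∧ moebius (rho (-1) 3 (by norm_num) (castQ (-1) 3 x)) τ = τ} ↦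
      ∃ v : ℍ[ℚ,((-1 : ℤ) : ℚ),((3 : ℤ) : ℚ)], (v ∈ order (-1) 3 ∨ v - ⟨1/2, 1/2, 1/2, -1/2⟩ ∈ order (-1) 3) ∧
        v * star v = 1 ∧ moebius (rho (-1) 3 (by norm_num) (castQ (-1) 3 v)) p.1 = q.1)),
        ((Nat.card
          {u : ℍ[ℚ,((-1 : ℤ) : ℚ),((3 : ℤ) : ℚ)] // (u ∈ order (-1) 3 ∨ u - ⟨1/2, 1/2, 1/2, -1/2⟩ ∈ order (-1) 3) ∧
            u * star u = 1 ∧ moebius (rho (-1) 3 (by norm_num) (castQ (-1) 3 u)) P.out.1 = P.out.1} : ℚ))⁻¹ = 1 / 2 := by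
  have h := finsum_normOne_classes_eq_two_mul_finsum_points (t := 1) one_pos
  rw [finsum_normOne_classes_one] at h
  linarith

/-- **`Σᶠ_{[τ] ∈ Pt(3)/Γ₆} |Γ₆,τ|⁻¹ = 1/3`** — the support of `Z(3)` is the two elliptic points of order `3` of `X₆`, each with
`|Γ₆,τ| = 6` (`ℤ[ζ₃]^×`): `2·⅙ = ⅓`, `deg Z(3)_ℚ = 2/3`. [cite: KudlaRapoportYang2006, §3.4 (3.4.14)] [cite: BayerTravesa2007, §1 Thm. 1.1] -/
theorem finsum_points_three :
    ∑ᶠ P : (Quot (fun p q : {τ : ℂ // 0 < τ.im ∧ ∃ x : ℍ[ℚ,((-1 : ℤ) : ℚ),((3 : ℤ) : ℚ)],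
        x ∈ order (-1) 3 ∧ x.re = 0 ∧ (x * star x).re = ((3 : ℤ) : ℚ) ∧ moebius (rho (-1) 3 (by norm_num) (castQ (-1) 3 x)) τ = τ} ↦
      ∃ v : ℍ[ℚ,((-1 : ℤ) : ℚ),((3 : ℤ) : ℚ)], (v ∈ order (-1) 3 ∨ v - ⟨1/2, 1/2, 1/2, -1/2⟩ ∈ order (-1) 3) ∧
        v * star v = 1 ∧ moebius (rho (-1) 3 (by norm_num) (castQ (-1) 3 v)) p.1 = q.1)),
        ((Nat.card
          {u : ℍ[ℚ,((-1 : ℤ) : ℚ),((3 : ℤ) : ℚ)] // (u ∈ order (-1) 3 ∨ u - ⟨1/2, 1/2, 1/2, -1/2⟩ ∈ order (-1) 3) ∧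
            u * star u = 1 ∧ moebius (rho (-1) 3 (by norm_num) (castQ (-1) 3 u)) P.out.1 = P.out.1} : ℚ))⁻¹ = 1 / 3 := by
  have h := finsum_normOne_classes_eq_two_mul_finsum_points (t := 3) (by norm_num)
  rw [finsum_normOne_classes_three] at h
  linarith

end Mass

end Literature.Geometry.Kaehler.ComplexTorus.QuaternionType
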